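import Literature.Analysis.FluidPDE.KNSSTypeIIZoomIn
import Summits.NavierStokesRegularity.NavierStokesRegularity.Theorems.CertifiedBlowupCertifiedBlowupAxisymBlowupSwirlPersists
import HarnessLib

/-!
# Near-maximum selection with an arbitrary factor `γ > 1`

Theorems file landed `--supports stmt-NavierStokesRegularity-0727` (crux `CertifiedBlowupAxisymBlowup`), line
`compact-amplification` (registered), sub-skeleton "axis-aware KNSS sup-zoom of a witness"
(`Cruxes/CertifiedBlowupAxisymBlowup/Lines/registered_zoom_probe.lean`), continuation lead c5.
This file proves stub Z2, `zoom_nearMax_gamma`: the near-maximum selection of KNSS 2009, §6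
(paragraph before Prop. 6.1, (6.2)–(6.3)) with an arbitrary factor `γ > 1` in place of the fixed
factor `2` of the tree's `Literature.Analysis.FluidPDE.exists_near_max` (file
`KNSSTypeIIZoomIn`). If `u` is bounded on `(0, T') × ℝ³` for every `T' < T` but not on
`(0, T) × ℝ³`, then for every `R` and every `γ > 1` there are `t₀ ∈ (0, T)` and `x₀` with
`R < ‖u(t₀, x₀)‖` and `‖u(s, y)‖ ≤ γ ‖u(t₀, x₀)‖` for all `s ∈ (0, t₀]` and all `y`. The proof
is the elementary `sup` argument of `exists_near_max` with the constants redone (Mathlib only: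
`le_csSup`, `exists_lt_of_lt_csSup`, `div_lt_self`).

## References
* H. Koch, N. Nadirashvili, G. Seregin, V. Šverák, Acta Math. 203 (2009) 83–105 = arXiv:0709.3599, §4, §6. [KochNadirashviliSereginSverak2009]
-/

set_option linter.dupNamespace false

noncomputable section

open MeasureTheory Set Function Filter Topology Metric
open scoped NNReal ENNReal

namespace Summit.NavierStokesRegularity.NavierStokesRegularity.Theorems.CertifiedBlowupAxisymBlowup.CompactAmplification

open Literature.Analysis Literature.Analysis.FluidPDE
open Summit.NavierStokesRegularity.NavierStokesRegularity.Theses.CertifiedBlowup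

local notation "ℝ³" => EuclideanSpace ℝ (Fin 3)

/-- **Near-maximum selection with factor `γ > 1`** (KNSS 2009, §6, p. 11: "`H(t) = sup_{0≤s≤t} h(s)`
… choose `x_k ∈ ℝⁿ` such that `M_k = |u(x_k, t_k)| ≥ H(t_k)/γ_k`", (6.3): `|v^{(k)}| ≤ γ_k`,
`|v^{(k)}(0,0)| = 1`). If `u : ℝ → ℝ³ → ℝ³` is bounded on `(0, T') × ℝ³` for every `T' < T` but
not on `(0, T) × ℝ³`, then for every `R` and every `γ > 1` there are `t₀ ∈ (0, T)` and `x₀` with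
`R < ‖u(t₀, x₀)‖` and `‖u(s, y)‖ ≤ γ ‖u(t₀, x₀)‖` for all `s ∈ (0, t₀]` and all `y`: take a value
above `γ · max(R, 0)` at some time `s₁ < T`, let `N` be the supremum of `‖u‖` over `(0, s₁] × ℝ³`
(finite by the bound on `(0, (s₁ + T)/2)`), and pick a point of `(0, s₁] × ℝ³` where `‖u‖`
exceeds `N/γ`. This is `Literature.Analysis.FluidPDE.exists_near_max` with `2` replaced by `γ`.
[cite: KochNadirashviliSereginSverak2009, §6 paragraph before Prop 6.1 with (6.2)–(6.3) (arXiv p. 11)] -/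
theorem zoom_nearMax_gamma : ∀ {u : ℝ → ℝ³ → ℝ³} {T : ℝ},
    (∀ T' < T, ∃ M : ℝ, ∀ t ∈ Ioo 0 T', ∀ x, ‖u t x‖ ≤ M) →
    (¬ ∃ M : ℝ, ∀ t ∈ Ioo 0 T, ∀ x, ‖u t x‖ ≤ M) → ∀ (R γ : ℝ), 1 < γ →
    ∃ t₀ ∈ Ioo 0 T, ∃ x₀ : ℝ³, R < ‖u t₀ x₀‖ ∧
      ∀ s ∈ Ioc 0 t₀, ∀ y, ‖u s y‖ ≤ γ * ‖u t₀ x₀‖ := by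
  intro u T hbdd hunb R γ hγ
  have hγ0 : 0 < γ := one_pos.trans hγ
  -- a large value at some time `s₁ < T`
  push Not at hunb
  obtain ⟨s₁, hs₁, x₁, hx₁⟩ := hunb (γ * max R 0)
  -- the supremum of `‖u‖` over `(0, s₁] × ℝ³`
  set S : Set ℝ := {r | ∃ s ∈ Ioc 0 s₁, ∃ y, r = ‖u s y‖} with hS
  obtain ⟨B, hB⟩ := hbdd ((s₁ + T) / 2) (by linarith [hs₁.2])
  have hSbdd : BddAbove S := by
    refine ⟨B, ?_⟩
    rintro r ⟨s, hs, y, rfl⟩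
    exact hB s ⟨hs.1, by linarith [hs.2, hs₁.2]⟩ y
  have hmem : ‖u s₁ x₁‖ ∈ S := ⟨s₁, ⟨hs₁.1, le_rfl⟩, x₁, rfl⟩
  have hSne : S.Nonempty := ⟨_, hmem⟩
  set N : ℝ := sSup S with hN
  have hN1 : ‖u s₁ x₁‖ ≤ N := le_csSup hSbdd hmem
  have hRN : γ * max R 0 < N := hx₁.trans_le hN1
  have hNpos : 0 < N := by
    have : 0 ≤ γ * max R 0 := mul_nonneg hγ0.le (le_max_right R 0)
    linarith
  -- a point of `(0, s₁] × ℝ³` where `‖u‖` exceeds `N / γ`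
  obtain ⟨r, ⟨t₀, ht₀, x₀, rfl⟩, hr⟩ := exists_lt_of_lt_csSup hSne (div_lt_self hNpos hγ)
  refine ⟨t₀, ⟨ht₀.1, ht₀.2.trans_lt hs₁.2⟩, x₀, ?_, fun s hs y => ?_⟩
  · -- `R ≤ max R 0 < N / γ < ‖u t₀ x₀‖`
    have h1 : max R 0 < N / γ := by
      rw [lt_div_iff₀ hγ0]
      linarith [mul_comm γ (max R 0)]
    exact (le_max_left R 0).trans_lt (h1.trans hr)
  · -- `‖u s y‖ ≤ N < γ ‖u t₀ x₀‖`
    have hsS : ‖u s y‖ ∈ S := ⟨s, ⟨hs.1, hs.2.trans ht₀.2⟩, y, rfl⟩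
    have h2 : N < γ * ‖u t₀ x₀‖ := by
      have h3 : N / γ < ‖u t₀ x₀‖ := hr
      rw [div_lt_iff₀ hγ0] at h3
      linarith [mul_comm γ ‖u t₀ x₀‖]
    linarith [le_csSup hSbdd hsS]

end Summit.NavierStokesRegularity.NavierStokesRegularity.Theorems.CertifiedBlowupAxisymBlowup.CompactAmplification

end
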